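import Literature.Barriers.RiemannHypothesis.TuranPartialSums
import HarnessLib

/-!
# Sections of `ζ` beyond `σ = 1`: no zeros of `ζ_7`, `ζ_8` in `σ ≥ 1` (Spira's table, proved)

Barrier catalogue `Literature/Barriers/RiemannHypothesis/`, companion of `TuranPartialSums.lean`
(proofs only). Spira 1968, §1/§4 reports "machine proofs that `ζ_N(s)` has no zeros with `σ ≥ 1` for
`N ≤ 9`" (an input of Platt–Trudgian 2016, Theorem 1.1 = `PlattTrudgian2016_thm11`); the tree proves
`N ≤ 6` (`zetaPartialSum_ne_zero_of_le_six`). This file proves the cases `N = 7` and `N = 8` by hand,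
on the closed half-plane `σ ≥ 1`:

* `zetaPartialSum_ne_zero_of_eq_seven`, `zetaPartialSum_ne_zero_of_eq_eight`, and the combined
  `zetaPartialSum_ne_zero_of_le_eight` (`1 ≤ N ≤ 8`, `Re s ≥ 1`).

## The argument (Platt–Trudgian 2016, §2.2: drop the primes occurring once, group the others)

Write `a = 2^{−s}`, `b = 3^{−s}`, `c = 5^{−s}`, `d = 7^{−s}`, `u = |a| = 2^{−σ} ∈ (0, 1/2]`,
`y = |1 + a| ∈ [1 − u, 1 + u]`. Then `ζ_7 = (1 + a + a²) + b(1 + a) + c + d` and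
`ζ_8 = (1 + a)(1 + a²) + b(1 + a) + c + d` (`4^{−s} = a²`, `6^{−s} = ab`, `8^{−s} = a³`), and for
`σ ≥ 1`, `|b| ≤ (2/3)u`, `|c| ≤ (2/5)u`, `|d| ≤ (2/7)u` (`p^{−σ} = 2^{−σ}(p/2)^{−σ} ≤ 2^{−σ}·2/p`), so
`|ζ_N| ≥ |core| − R` with `R = (2u/3) y + (24/35) u`. The cores are controlled by the exact identities
`|1 + a + a²|² = y⁴ − (1 + u²)y² + 1 − u² + u⁴` and `|(1 + a)(1 + a²)|² = y²((1 − u²)² + (y² − 1 − u²)²)`,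
and `|core|² − R²`, a polynomial in `(u², y)` decreasing in `u²` on `[0, 1/4]`, is bounded below by
its value at `u² = 1/4`, a one-variable polynomial in `y` which is positive (for `N = 7` on all of
`ℝ`: `(y² − 3/4)² + (5/36)(y − 144/175)² + 941/24500`; for `N = 8` on `y ≥ 1/2`). The minimal
margins (`|core| − R ≈ 0.030` for `N = 7` at `σ = 1`, `cos θ₂ ≈ −1/2`; `≈ 0.110` for `N = 8`) agree
with Spira's Table II being needed from `N = 9` on, where the three terms in `3^{−s}` no longer factor
through `1 + a` and a genuinely two-dimensional search is required (not done here).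

## References

* [Spira1968] R. Spira, *Zeros of sections of the zeta function. II*, Math. Comp. 22 (1968),
  163–173, §1 and §4 (Table II: `N = 6` to `9`).
* [PlattTrudgian2016] D. J. Platt, T. S. Trudgian, LMS J. Comput. Math. 19 (2016), 37–41, §2.2
  (elimination of primes occurring once; cosine-rule grouping).
-/

noncomputable section

open Complex

namespace Literature.Barriers.RiemannHypothesis

/-! ## Sizes of the prime-power terms for `σ ≥ 1` -/

/-- For `n ≥ 2` and `σ ≥ 1`: `n^{−σ} ≤ (2/n) · 2^{−σ}` (since `(n/2)^{−σ} ≤ (n/2)^{−1}`). [folklore] -/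
theorem rpow_neg_le_two_div_mul_two_rpow_neg {n σ : ℝ} (hn : 2 ≤ n) (hσ : 1 ≤ σ) :
    n ^ (-σ) ≤ 2 / n * (2 : ℝ) ^ (-σ) := by
  have hn0 : 0 < n := by linarith
  have e : n ^ (-σ) = (2 : ℝ) ^ (-σ) * (n / 2) ^ (-σ) := by
    rw [← Real.mul_rpow (by norm_num) (by positivity)]
    congr 1
    ring
  rw [e, mul_comm (2 / n)]
  have h2 : 0 ≤ (2 : ℝ) ^ (-σ) := Real.rpow_nonneg (by norm_num) _
  refine mul_le_mul_of_nonneg_left ?_ h2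
  calc (n / 2) ^ (-σ) ≤ (n / 2) ^ (-1 : ℝ) :=
        Real.rpow_le_rpow_of_exponent_le (by linarith) (by linarith)
    _ = 2 / n := by rw [Real.rpow_neg_one, inv_div]

/-- `|2^{−s}| = 2^{−σ}`. [folklore] -/
theorem norm_two_cpow_neg (s : ℂ) : ‖(2 : ℂ) ^ (-s)‖ = (2 : ℝ) ^ (-s.re) := by
  simpa using Complex.norm_natCast_cpow_of_pos (n := 2) Nat.two_pos (-s)

/-- `0 < 2^{−σ} ≤ 1/2` for `σ ≥ 1`. [folklore] -/
theorem two_rpow_neg_pos_le_half {σ : ℝ} (hσ : 1 ≤ σ) :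
    0 < (2 : ℝ) ^ (-σ) ∧ (2 : ℝ) ^ (-σ) ≤ 1 / 2 := by
  refine ⟨Real.rpow_pos_of_pos (by norm_num) _, ?_⟩
  calc (2 : ℝ) ^ (-σ) ≤ (2 : ℝ) ^ (-1 : ℝ) :=
        Real.rpow_le_rpow_of_exponent_le (by norm_num) (by linarith)
    _ = 1 / 2 := by rw [Real.rpow_neg_one, one_div]

/-- `|p^{−s}| ≤ (2/p) 2^{−σ}` for a natural `p ≥ 2` and `σ = Re s ≥ 1`. [folklore] -/
theorem norm_natCast_cpow_neg_le {p : ℕ} (hp : 2 ≤ p) {s : ℂ} (hs : 1 ≤ s.re) :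
    ‖(p : ℂ) ^ (-s)‖ ≤ 2 / (p : ℝ) * (2 : ℝ) ^ (-s.re) := by
  rw [Complex.norm_natCast_cpow_of_pos (by omega), neg_re]
  exact rpow_neg_le_two_div_mul_two_rpow_neg (by exact_mod_cast hp) hs

/-! ## The sections `ζ_7`, `ζ_8` in the prime terms -/

/-- `ζ_7 = 1 + a + b + a² + c + ab + d` with `a = 2^{−s}`, `b = 3^{−s}`, `c = 5^{−s}`, `d = 7^{−s}`.
[folklore] -/
theorem zetaPartialSum_seven_eq (s : ℂ) :
    zetaPartialSum 7 s = 1 + (2 : ℂ) ^ (-s) + (3 : ℂ) ^ (-s) + ((2 : ℂ) ^ (-s)) ^ 2 + (5 : ℂ) ^ (-s) +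
      (2 : ℂ) ^ (-s) * (3 : ℂ) ^ (-s) + (7 : ℂ) ^ (-s) := by
  obtain ⟨-, -, -, -, -, e6⟩ := zetaPartialSum_six_expand s
  have h7 : ((6 : ℕ) : ℂ) + 1 = (7 : ℂ) := by norm_num
  rw [show (7 : ℕ) = 6 + 1 from rfl, zetaPartialSum_succ, h7, e6]

/-- `8^{−s} = (2^{−s})³`. [folklore] -/
theorem eight_cpow_neg (s : ℂ) : (8 : ℂ) ^ (-s) = ((2 : ℂ) ^ (-s)) ^ 3 := by
  have h4 : (4 : ℂ) ^ (-s) = ((2 : ℂ) ^ (-s)) ^ 2 := by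
    rw [show (4 : ℂ) = ((2 : ℕ) : ℂ) * ((2 : ℕ) : ℂ) by norm_num, natCast_mul_natCast_cpow, sq]
    norm_num
  rw [show (8 : ℂ) = ((2 : ℕ) : ℂ) * ((4 : ℕ) : ℂ) by norm_num, natCast_mul_natCast_cpow]
  push_cast
  rw [h4]
  ring

/-- `ζ_8 = 1 + a + b + a² + c + ab + d + a³`. [folklore] -/
theorem zetaPartialSum_eight_eq (s : ℂ) :
    zetaPartialSum 8 s = 1 + (2 : ℂ) ^ (-s) + (3 : ℂ) ^ (-s) + ((2 : ℂ) ^ (-s)) ^ 2 + (5 : ℂ) ^ (-s) +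
      (2 : ℂ) ^ (-s) * (3 : ℂ) ^ (-s) + (7 : ℂ) ^ (-s) + ((2 : ℂ) ^ (-s)) ^ 3 := by
  have h8 : ((7 : ℕ) : ℂ) + 1 = (8 : ℂ) := by norm_num
  rw [show (8 : ℕ) = 7 + 1 from rfl, zetaPartialSum_succ, h8, zetaPartialSum_seven_eq, eight_cpow_neg]

/-! ## The two norm identities -/

/-- `|1 + a + a²|² = y⁴ − (1 + u²) y² + 1 − u² + u⁴` with `y = |1 + a|`, `u = |a|`. [folklore] -/
theorem norm_sq_one_add_add_sq (a : ℂ) :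
    ‖1 + a + a ^ 2‖ ^ 2 =
      (‖1 + a‖ ^ 2) ^ 2 - (1 + ‖a‖ ^ 2) * ‖1 + a‖ ^ 2 + 1 - ‖a‖ ^ 2 + (‖a‖ ^ 2) ^ 2 := by
  have h2 : a ^ 2 = a * a := sq a
  simp only [h2, Complex.sq_norm, Complex.normSq_apply, add_re, add_im, one_re, one_im, mul_re,
    mul_im]
  ring

/-- `|1 + a²|² = (1 − u²)² + (y² − 1 − u²)²` with `y = |1 + a|`, `u = |a|`. [folklore] -/
theorem norm_sq_one_add_sq (a : ℂ) :
    ‖1 + a ^ 2‖ ^ 2 = (1 - ‖a‖ ^ 2) ^ 2 + (‖1 + a‖ ^ 2 - 1 - ‖a‖ ^ 2) ^ 2 := by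
  have h2 : a ^ 2 = a * a := sq a
  simp only [h2, Complex.sq_norm, Complex.normSq_apply, add_re, add_im, one_re, one_im, mul_re,
    mul_im]
  ring

/-- `y = |1 + a| ≥ 1 − |a|`. [folklore] -/
theorem one_sub_norm_le_norm_one_add (a : ℂ) : 1 - ‖a‖ ≤ ‖1 + a‖ := by
  have := norm_sub_norm_le (1 : ℂ) (-a)
  simpa [sub_neg_eq_add] using this

/-! ## The one-variable inequalities -/

/-- `N = 7`: for `0 ≤ u² ≤ 1/4` and real `y`,
`((2/3) u y + (24/35) u)² < y⁴ − (1 + u²) y² + 1 − u² + u⁴`. The difference is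
`(1/4 − u²)(y² + 3/4 − u² + ((2/3)y + 24/35)²) + (y² − 3/4)² + (5/36)(y − 144/175)² + 941/24500`.
[folklore] -/
theorem seven_key_ineq {u y : ℝ} (hU : u ^ 2 ≤ 1 / 4) :
    (2 / 3 * u * y + 24 / 35 * u) ^ 2 <
      (y ^ 2) ^ 2 - (1 + u ^ 2) * y ^ 2 + 1 - u ^ 2 + (u ^ 2) ^ 2 := by
  have hQ : 0 < (y ^ 2 - 3 / 4) ^ 2 + 5 / 36 * (y - 144 / 175) ^ 2 + 941 / 24500 := by positivity
  have h14 : 0 ≤ 1 / 4 - u ^ 2 := by linarith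
  have hS : 0 ≤ y ^ 2 + 1 + (2 / 3 * y + 24 / 35) ^ 2 - 1 / 4 - u ^ 2 := by
    nlinarith [sq_nonneg y, sq_nonneg (2 / 3 * y + 24 / 35)]
  nlinarith [mul_nonneg h14 hS, hQ]

/-- `N = 8`, the one-variable polynomial: for `y ≥ 1/2`,
`0 < y²(9/16 + (y² − 5/4)²) − (1/4)((2/3)y + 24/35)²`. [folklore] -/
theorem eight_Q_pos {y : ℝ} (hy : 1 / 2 ≤ y) :
    0 < y ^ 2 * (9 / 16 + (y ^ 2 - 5 / 4) ^ 2) - 1 / 4 * (2 / 3 * y + 24 / 35) ^ 2 := by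
  -- `Q₈ = (y(y² − 5/4))² + r(y)`, `r(y) = (65/144)y² − (8/35)y − 144/1225`
  have hdec : y ^ 2 * (9 / 16 + (y ^ 2 - 5 / 4) ^ 2) - 1 / 4 * (2 / 3 * y + 24 / 35) ^ 2 =
      (y * (y ^ 2 - 5 / 4)) ^ 2 + (65 / 144 * y ^ 2 - 8 / 35 * y - 144 / 1225) := by ring
  rw [hdec]
  rcases le_or_gt (5 / 6 : ℝ) y with h56 | h56
  · -- `r` is increasing on `y ≥ 5/6` and `r(5/6) > 0`
    have h1 : 0 ≤ y - 5 / 6 := by linarith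
    have h2 : 0 ≤ 65 / 144 * (y + 5 / 6) - 8 / 35 := by linarith
    nlinarith [mul_nonneg h1 h2, sq_nonneg (y * (y ^ 2 - 5 / 4))]
  · -- on `[1/2, 5/6]`: `y(5/4 − y²) ≥ 23/50` and `r(y) ≥ r(1/2)`
    have h1 : 0 ≤ y - 1 / 2 := by linarith
    have h2 : 0 ≤ 5 / 6 - y := by linarith
    have hy0 : 0 ≤ y := by linarith
    have hw : 23 / 50 ≤ y * (5 / 4 - y ^ 2) := by
      nlinarith [mul_nonneg (mul_nonneg h1 h2) hy0, mul_nonneg h1 h2]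
    have hw2 : (23 / 50 : ℝ) ^ 2 ≤ (y * (5 / 4 - y ^ 2)) ^ 2 := pow_le_pow_left₀ (by norm_num) hw 2
    have hw3 : (y * (y ^ 2 - 5 / 4)) ^ 2 = (y * (5 / 4 - y ^ 2)) ^ 2 := by ring
    have h3 : 0 ≤ 65 / 144 * (y + 1 / 2) - 8 / 35 := by linarith
    nlinarith [mul_nonneg h1 h3, hw2, hw3]

/-- `N = 8`: for `0 ≤ u² ≤ 1/4` and `y ≥ 1/2`,
`((2/3) u y + (24/35) u)² < y²((1 − u²)² + (y² − 1 − u²)²)`. The difference minus its value at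
`u² = 1/4` is `(1/4 − u²)(2y⁴ + ((2/3)y + 24/35)² − 2y²(u² + 1/4)) ≥ 0`. [folklore] -/
theorem eight_key_ineq {u y : ℝ} (hU : u ^ 2 ≤ 1 / 4) (hy : 1 / 2 ≤ y) :
    (2 / 3 * u * y + 24 / 35 * u) ^ 2 <
      y ^ 2 * ((1 - u ^ 2) ^ 2 + (y ^ 2 - 1 - u ^ 2) ^ 2) := by
  have hQ := eight_Q_pos hy
  have h14 : 0 ≤ 1 / 4 - u ^ 2 := by linarith
  have hy0 : 0 ≤ y := by linarith
  have hB : 0 ≤ 2 * (y ^ 2) ^ 2 + (2 / 3 * y + 24 / 35) ^ 2 - 2 * y ^ 2 * (u ^ 2 + 1 / 4) := by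
    nlinarith [mul_nonneg (sq_nonneg y) h14, sq_nonneg (y ^ 2 - 5 / 36), hy0]
  nlinarith [mul_nonneg h14 hB, hQ]

/-! ## `N = 7` and `N = 8` -/

/-- **`ζ_7(s) ≠ 0` for `Re s ≥ 1`** (a case of Spira 1968, §4, Table II; proved here by hand):
`|ζ_7| ≥ |1 + a + a²| − |b||1 + a| − |c| − |d| > 0`. [cite: Spira1968, §4] -/
theorem zetaPartialSum_ne_zero_of_eq_seven {s : ℂ} (hs : 1 ≤ s.re) : zetaPartialSum 7 s ≠ 0 := by
  rw [zetaPartialSum_seven_eq]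
  set a : ℂ := (2 : ℂ) ^ (-s) with ha
  set b : ℂ := (3 : ℂ) ^ (-s) with hb
  set c : ℂ := (5 : ℂ) ^ (-s) with hc
  set d : ℂ := (7 : ℂ) ^ (-s) with hd
  set u : ℝ := (2 : ℝ) ^ (-s.re) with hu
  obtain ⟨hu0, hu2⟩ := two_rpow_neg_pos_le_half hs
  have hU : u ^ 2 ≤ 1 / 4 := by nlinarith
  have na : ‖a‖ = u := norm_two_cpow_neg s
  have nb : ‖b‖ ≤ 2 / 3 * u := by
    simpa using norm_natCast_cpow_neg_le (p := 3) (by norm_num) hs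
  have nc : ‖c‖ ≤ 2 / 5 * u := by
    simpa using norm_natCast_cpow_neg_le (p := 5) (by norm_num) hs
  have nd : ‖d‖ ≤ 2 / 7 * u := by
    simpa using norm_natCast_cpow_neg_le (p := 7) (by norm_num) hs
  set y : ℝ := ‖1 + a‖ with hy
  have hy0 : 0 ≤ y := norm_nonneg _
  -- the core dominates
  have hA : ‖1 + a + a ^ 2‖ ^ 2 = (y ^ 2) ^ 2 - (1 + u ^ 2) * y ^ 2 + 1 - u ^ 2 + (u ^ 2) ^ 2 := by
    rw [hy, ← na]; exact norm_sq_one_add_add_sq a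
  have key : (2 / 3 * u * y + 24 / 35 * u) ^ 2 < ‖1 + a + a ^ 2‖ ^ 2 := by
    rw [hA]; exact seven_key_ineq hU
  have hcore : 2 / 3 * u * y + 24 / 35 * u < ‖1 + a + a ^ 2‖ :=
    lt_of_pow_lt_pow_left₀ 2 (norm_nonneg _) key
  -- the rest is small
  intro h0
  have heq : 1 + a + a ^ 2 = -(b * (1 + a) + c + d) := by linear_combination h0
  have h1 : ‖1 + a + a ^ 2‖ ≤ 2 / 3 * u * y + 24 / 35 * u := by
    rw [heq, norm_neg]
    calc ‖b * (1 + a) + c + d‖ ≤ ‖b * (1 + a)‖ + ‖c‖ + ‖d‖ := norm_add₃_le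
      _ = ‖b‖ * y + ‖c‖ + ‖d‖ := by rw [norm_mul]
      _ ≤ 2 / 3 * u * y + 2 / 5 * u + 2 / 7 * u := by gcongr
      _ = 2 / 3 * u * y + 24 / 35 * u := by ring
  linarith

/-- **`ζ_8(s) ≠ 0` for `Re s ≥ 1`** (a case of Spira 1968, §4, Table II; proved here by hand):
`|ζ_8| ≥ |1 + a||1 + a²| − |b||1 + a| − |c| − |d| > 0`. [cite: Spira1968, §4] -/
theorem zetaPartialSum_ne_zero_of_eq_eight {s : ℂ} (hs : 1 ≤ s.re) : zetaPartialSum 8 s ≠ 0 := by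
  rw [zetaPartialSum_eight_eq]
  set a : ℂ := (2 : ℂ) ^ (-s) with ha
  set b : ℂ := (3 : ℂ) ^ (-s) with hb
  set c : ℂ := (5 : ℂ) ^ (-s) with hc
  set d : ℂ := (7 : ℂ) ^ (-s) with hd
  set u : ℝ := (2 : ℝ) ^ (-s.re) with hu
  obtain ⟨hu0, hu2⟩ := two_rpow_neg_pos_le_half hs
  have hU : u ^ 2 ≤ 1 / 4 := by nlinarith
  have na : ‖a‖ = u := norm_two_cpow_neg s
  have nb : ‖b‖ ≤ 2 / 3 * u := by
    simpa using norm_natCast_cpow_neg_le (p := 3) (by norm_num) hs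
  have nc : ‖c‖ ≤ 2 / 5 * u := by
    simpa using norm_natCast_cpow_neg_le (p := 5) (by norm_num) hs
  have nd : ‖d‖ ≤ 2 / 7 * u := by
    simpa using norm_natCast_cpow_neg_le (p := 7) (by norm_num) hs
  set y : ℝ := ‖1 + a‖ with hy
  have hy0 : 0 ≤ y := norm_nonneg _
  have hy2 : 1 / 2 ≤ y := by
    have := one_sub_norm_le_norm_one_add a
    rw [na] at this
    linarith
  -- the core dominates
  have hA : ‖(1 + a) * (1 + a ^ 2)‖ ^ 2 = y ^ 2 * ((1 - u ^ 2) ^ 2 + (y ^ 2 - 1 - u ^ 2) ^ 2) := by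
    rw [norm_mul, mul_pow, hy, ← na, norm_sq_one_add_sq a]
  have key : (2 / 3 * u * y + 24 / 35 * u) ^ 2 < ‖(1 + a) * (1 + a ^ 2)‖ ^ 2 := by
    rw [hA]; exact eight_key_ineq hU hy2
  have hcore : 2 / 3 * u * y + 24 / 35 * u < ‖(1 + a) * (1 + a ^ 2)‖ :=
    lt_of_pow_lt_pow_left₀ 2 (norm_nonneg _) key
  -- the rest is small
  intro h0
  have heq : (1 + a) * (1 + a ^ 2) = -(b * (1 + a) + c + d) := by linear_combination h0
  have h1 : ‖(1 + a) * (1 + a ^ 2)‖ ≤ 2 / 3 * u * y + 24 / 35 * u := by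
    rw [heq, norm_neg]
    calc ‖b * (1 + a) + c + d‖ ≤ ‖b * (1 + a)‖ + ‖c‖ + ‖d‖ := norm_add₃_le
      _ = ‖b‖ * y + ‖c‖ + ‖d‖ := by rw [norm_mul]
      _ ≤ 2 / 3 * u * y + 2 / 5 * u + 2 / 7 * u := by gcongr
      _ = 2 / 3 * u * y + 24 / 35 * u := by ring
  linarith

/-- **No zeros of `ζ_N` in `σ ≥ 1` for `1 ≤ N ≤ 8`** (the tree's `N ≤ 6` and the two cases above):
the part of Spira's machine proof (`N ≤ 9`, Spira 1968, §1/§4) that is now a theorem.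
[cite: Spira1968, §1 and §4] -/
theorem zetaPartialSum_ne_zero_of_le_eight {N : ℕ} (hN1 : 1 ≤ N) (hN8 : N ≤ 8) {s : ℂ}
    (hs : 1 ≤ s.re) : zetaPartialSum N s ≠ 0 := by
  rcases Nat.lt_or_ge N 7 with h | h
  · exact zetaPartialSum_ne_zero_of_le_six hN1 (by omega) hs
  · rcases Nat.lt_or_ge N 8 with h' | h'
    · rw [show N = 7 by omega]; exact zetaPartialSum_ne_zero_of_eq_seven hs
    · rw [show N = 8 by omega]; exact zetaPartialSum_ne_zero_of_eq_eight hs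

/-- In particular (Theorem 1.1 (i), cases `N ≤ 8`, open half-plane as printed).
[cite: PlattTrudgian2016, Theorem 1.1] -/
theorem PlattTrudgian2016_thm11_le_eight (N : ℕ) (hN1 : 1 ≤ N) (hN8 : N ≤ 8) (s : ℂ)
    (hs : 1 < s.re) : zetaPartialSum N s ≠ 0 :=
  zetaPartialSum_ne_zero_of_le_eight hN1 hN8 hs.le

end Literature.Barriers.RiemannHypothesis
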